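import Literature.NumberTheory.EllipticCurves.SelmerPInftyRestrictionJZero
import Literature.NumberTheory.EllipticCurves.SelmerTorsionRestriction
import HarnessLib

/-!
# `Sel_n(E/ℚ) = Sel_n(E_K/K)^{Gal(K/ℚ)}` for `j = 0` short models and `K = ℚ(ω)` (finite level)

The finite-level (`E[n]`, any `n : ℤ`; the route uses `n = 2^M`) companion of
`SelmerPInftyRestrictionJZero` (`E[p^∞]`) and `ShaRestrictionJZeroInvariants` (`E(K̄)`), on the
tree's finite-level vocabulary of `SelmerTorsionRestriction` (`resTorsion`, `modelIsoTorsion`,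
`modelIsoTorsion_resTorsion`, `modelIsoTorsion_conjAct`, `conjAct_resTorsion`): for `E : y² = x³ + b`
over `ℚ`, `K` a quadratic number field with a primitive cube root of unity `ζ`, `σ ζ = ζ²`,

* `JZero.resTorsion_injective` — `res : H¹(ℚ, E[n]) → H¹(K, E_K[n])` is INJECTIVE for EVERY `n`
  (the tree's `resTorsion_injective_of_odd` needs `n = p` odd; here the `[ω]`-trick
  `resSubgroupH1_injective_of_semilinear` kills the kernel `H¹(Gal(K/ℚ), E_K[n](K))` also for even `n`);
* `JZero.exists_resTorsion_eq_of_conjAct_eq`, `JZero.range_resTorsion_eq` — its image is EXACTLY the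
  `σ`-invariants (`conjAct W σ n`), by CM corestriction (`exists_resSubgroupH1_eq_of_conjH1_eq`);
* `JZero.mem_selmerGroup_iff_resTorsion_mem`, `JZero.selmerGroup_eq_comap_resTorsion` —
  `Sel_n(E/ℚ) = res⁻¹ Sel_n(E_K/K)` (exact local descent `JZero.mem_sha_iff_resBaseChange_mem_sha_rat`
  through `selmerGroup_eq_comap_sha`);
* `JZero.existsUnique_resTorsion_eq_of_mem_selmerGroup`, `JZero.image_resTorsion_selmerGroup_eq` —
  `res : Sel_n(E/ℚ) ⥲ Sel_n(E_K/K)^{σ}`: the memo's «`Sel_{2^M}(X/K) = Sel_{2^M}(X/ℚ) ⊗ 𝒪/2^M`» in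
  `σ`-eigen form (with the `[ω]`-structure of `SelmerTorsionCMOperatorJZero`).

Everything is proved; no new definitions.

## References

* J.-P. Serre, *Galois Cohomology* (1997), I.§2.4–2.5, I.§5.8. [SerreGaloisCohomology1997]
* B. H. Gross, Kolyvagin's work on modular elliptic curves (1991), §5 (5.1)–(5.2). [GrossLMS1991]
* T. Dokchitser, V. Dokchitser, Ann. of Math. 172 (2010), Lemma 4.14 (proof). [DokchitserDokchitserAnnals2010]
* J. H. Silverman, *The Arithmetic of Elliptic Curves*, 2nd ed. (2009), III.10.1, X.§4. [SilvermanAEC2009]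
-/

noncomputable section

open scoped Classical

namespace Literature.NumberTheory.EllipticCurves

open GaloisRepresentations WeierstrassCurve Literature.NumberTheory.QuadraticFields

namespace JZero

variable (K : Type) [Field K] [NumberField K] (W : WeierstrassCurve ℚ) [W.IsElliptic] (n : ℤ)

/-! ## The restriction of `[ω]` to `E[n]` -/

omit [W.IsElliptic] in
/-- An additive automorphism of `E(ℚ̄)` maps `E[n]` into itself. [folklore] -/
private theorem mem_geomTorsion_of_addEquiv (ψ : geomPoints W ≃+ geomPoints W)
    {P : geomPoints W} (hP : P ∈ geomTorsion W n) : ψ P ∈ geomTorsion W n := by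
  rw [mem_geomTorsion_iff] at hP ⊢
  rw [← map_zsmul, hP, map_zero]

/-- **`[ω]` on `E[n]`.** For an elliptic `j = 0` short model over `ℚ` and a primitive cube root of
unity `ζ' ∈ ℚ̄`: an additive automorphism `ψ` of `E[n] ⊆ E(ℚ̄)` (the restriction of `[ω]`,
`JZero.exists_cm_addEquiv_semilinear`) commuting with every `g ∈ Γ_ℚ` fixing `ζ'`, semilinear
(`g ψ = ψ² g`) for `g ζ' = ζ'²`, with `ψ² + ψ + 1 = 0`. Silverman, *AEC*, III.10.1. [folklore] -/
private theorem exists_cm_addEquiv_torsion (ha₁ : W.a₁ = 0) (ha₂ : W.a₂ = 0) (ha₃ : W.a₃ = 0)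
    (ha₄ : W.a₄ = 0) {ζ' : AlgebraicClosure ℚ} (hζ'3 : ζ' ^ 3 = 1) (hζ'1 : ζ' ≠ 1) :
    ∃ ψ : geomTorsion W n ≃+ geomTorsion W n,
      (∀ g : Field.absoluteGaloisGroup ℚ,
        (show AlgebraicClosure ℚ ≃ₐ[ℚ] AlgebraicClosure ℚ from g) ζ' = ζ' →
          ∀ P : geomTorsion W n, ψ (g • P) = g • ψ P) ∧
      (∀ g : Field.absoluteGaloisGroup ℚ,
        (show AlgebraicClosure ℚ ≃ₐ[ℚ] AlgebraicClosure ℚ from g) ζ' = ζ' ^ 2 →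
          ∀ P : geomTorsion W n, g • ψ P = ψ (ψ (g • P))) ∧
      ∀ P : geomTorsion W n, ψ (ψ P) + ψ P + P = 0 := by
  obtain ⟨ψ, -, h1, h2, h3⟩ := exists_cm_addEquiv_semilinear (W := W) ha₁ ha₂ ha₃ ha₄ hζ'3 hζ'1
  let ψn : geomTorsion W n ≃+ geomTorsion W n :=
    { toFun := fun P ↦ ⟨ψ P, mem_geomTorsion_of_addEquiv W n ψ P.2⟩
      invFun := fun Q ↦ ⟨ψ.symm Q, mem_geomTorsion_of_addEquiv W n ψ.symm Q.2⟩
      left_inv := fun P ↦ Subtype.ext (ψ.symm_apply_apply (P : geomPoints W))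
      right_inv := fun Q ↦ Subtype.ext (ψ.apply_symm_apply (Q : geomPoints W))
      map_add' := fun P Q ↦ Subtype.ext (map_add ψ (P : geomPoints W) (Q : geomPoints W)) }
  have hψn : ∀ P : geomTorsion W n, ((ψn P : geomTorsion W n) : geomPoints W) = ψ P :=
    fun _ ↦ rfl
  refine ⟨ψn, fun g hg P ↦ Subtype.ext ?_, fun g hg P ↦ Subtype.ext ?_, fun P ↦ Subtype.ext ?_⟩
  · rw [hψn, AddSubgroup.torsionBy.coe_smul, AddSubgroup.torsionBy.coe_smul, hψn]
    exact h1 g hg P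
  · rw [AddSubgroup.torsionBy.coe_smul, hψn, hψn, hψn, AddSubgroup.torsionBy.coe_smul]
    exact h2 g hg P
  · rw [AddSubgroup.coe_add, AddSubgroup.coe_add, AddSubgroup.coe_zero]
    exact h3 P

omit [W.IsElliptic] in
/-- `σ ζ = ζ²` for a primitive cube root of unity forces `σ ≠ 1`. [folklore] -/
private theorem ne_one_of_apply_eq_sq₃ {ζ : K} (hζ : IsPrimitiveRoot ζ 3) {σ : K ≃ₐ[ℚ] K}
    (hσζ : σ ζ = ζ ^ 2) : σ ≠ 1 := by
  intro h
  rw [h, AlgEquiv.one_apply] at hσζ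
  have hζ0 : ζ ≠ 0 := hζ.ne_zero (by norm_num)
  have hζ1 : ζ ≠ 1 := hζ.ne_one (by norm_num)
  have : ζ * (ζ - 1) = 0 := by linear_combination hσζ.symm
  rcases mul_eq_zero.mp this with h0 | h0
  · exact hζ0 h0
  · exact hζ1 (sub_eq_zero.mp h0)

omit [NumberField K] [W.IsElliptic] in
/-- `ζ² + ζ + 1 = 0` for a primitive cube root of unity. [folklore] -/
private theorem sq_add_self_add_one_eq_zero {ζ : K} (hζ : IsPrimitiveRoot ζ 3) :
    ζ ^ 2 + ζ + 1 = 0 := by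
  have h3 : ζ ^ 3 = 1 := hζ.pow_eq_one
  have h1 : ζ ≠ 1 := hζ.ne_one (by norm_num)
  have hprod : (ζ - 1) * (ζ ^ 2 + ζ + 1) = 0 := by linear_combination h3
  rcases mul_eq_zero.mp hprod with h | h
  · exact absurd (sub_eq_zero.mp h) h1
  · exact h

omit [W.IsElliptic] in
/-- The `Γ_ℚ`-orbit maps of `E[n]` are continuous (discrete coefficients: open stabilizers).
[folklore] -/
private theorem continuous_smul_geomTorsion (m : geomTorsion W n) :
    Continuous fun g : Field.absoluteGaloisGroup ℚ ↦ g • m :=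
  continuous_induced_rng.2 (by
    change Continuous fun g : Field.absoluteGaloisGroup ℚ ↦ ((g • m : geomTorsion W n) : geomPoints W)
    simp only [AddSubgroup.torsionBy.coe_smul]
    exact continuous_smul_of_isOpen_stabilizer (m : geomPoints W) (isOpen_stabilizer_point_holds W _))

/-! ## Injectivity and the image of `res : H¹(ℚ, E[n]) → H¹(K, E_K[n])` -/

/-- **`res : H¹(ℚ, E[n]) → H¹(K, E_K[n])` is INJECTIVE for every `n`** for `E = W/ℚ` elliptic with
all of `a₁, …, a₄` zero, `K` a quadratic number field with a primitive cube root of unity `ζ` and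
`σ ζ = ζ²`: `H¹(Gal(K/ℚ), E_K[n](K)) = 0` by the `[ω]`-trick (`resSubgroupH1_injective_of_semilinear`
on the `[ω]`-stable module `E[n]`), transported through the subgroup model
(`modelIsoTorsion_resTorsion`). Compare the tree's `resTorsion_injective_of_odd` (`n = p` odd, any
quadratic `K`) and `two_nsmul_eq_zero_of_resTorsion_eq_zero`.
[cite: SerreGaloisCohomology1997, I.§2.4 (Prop. 9 and Cor.) and I.§5.8]
[cite: SilvermanAEC2009, Thm. III.10.1 and Cor. III.10.2] -/
theorem resTorsion_injective (ha₁ : W.a₁ = 0) (ha₂ : W.a₂ = 0) (ha₃ : W.a₃ = 0) (ha₄ : W.a₄ = 0)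
    (h2 : Module.finrank ℚ K = 2) {ζ : K} (hζ : IsPrimitiveRoot ζ 3) {σ : K ≃ₐ[ℚ] K}
    (hσζ : σ ζ = ζ ^ 2) : Function.Injective (resTorsion W K n) := by
  haveI : IsGalois ℚ K := by
    haveI : Algebra.IsQuadraticExtension ℚ K := ⟨h2⟩
    infer_instance
  haveI : Algebra.IsAlgebraic ℚ K := Algebra.IsAlgebraic.of_finite ℚ K
  have hσ1 : σ ≠ 1 := ne_one_of_apply_eq_sq₃ K hζ hσζ
  haveI hNn : (galRange (K := ℚ) K).Normal := normal_galRange K h2 hσ1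
  have hN : IsOpen (galRange (K := ℚ) K : Set (Field.absoluteGaloisGroup ℚ)) := isOpen_galRange K
  have hc := xor_galRange K h2 hσ1
  obtain ⟨ζ', hζ'⟩ : ∃ ζ' : AlgebraicClosure ℚ, embIntoClosure (K := ℚ) K ζ = ζ' := ⟨_, rfl⟩
  have hζ'3 : ζ' ^ 3 = 1 := by rw [← hζ', ← map_pow, hζ.pow_eq_one, map_one]
  have hζ'1 : ζ' ≠ 1 :=
    (hζ' ▸ hζ.map_of_injective (embIntoClosure (K := ℚ) K).injective).ne_one (by norm_num)
  have hcζ : (show AlgebraicClosure ℚ ≃ₐ[ℚ] AlgebraicClosure ℚ from liftToAbsGal (K := ℚ) K σ) ζ' =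
      ζ' ^ 2 := by
    rw [← hζ']
    exact (liftToAbsGal_embIntoClosure (K := ℚ) K σ ζ).trans (by rw [hσζ, map_pow])
  obtain ⟨ψ, hψ1, hψ2, hψ3⟩ := exists_cm_addEquiv_torsion W n ha₁ ha₂ ha₃ ha₄ hζ'3 hζ'1
  have hψN : ∀ (g : galRange (K := ℚ) K) (m : geomTorsion W n), ψ (g • m) = g • ψ m :=
    fun g m ↦ hψ1 g.1 (by rw [← hζ']; exact smul_embIntoClosure_of_mem_galRange K g.2 ζ) m
  have hinj := resSubgroupH1_injective_of_semilinear hN hc ψ hψN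
    (fun m ↦ hψ2 _ hcζ m) hψ3
  intro x y hxy
  have h := congrArg (modelIsoTorsion K W n) hxy
  rw [modelIsoTorsion_resTorsion, modelIsoTorsion_resTorsion] at h
  exact hinj h

/-- **INVARIANT CLASSES OF `H¹(K, E_K[n])` ARE RESTRICTIONS**: for `E`, `K`, `ζ`, `σ` as in
`resTorsion_injective`, every `s ∈ H¹(K, E_K[n])` with `σ_* s = s` (the tree's `conjAct W σ n`) is
`res η` (`resTorsion`) for some `η ∈ H¹(ℚ, E[n])`: CM corestriction `η = cor(−[ω]_* s)`
(`exists_resSubgroupH1_eq_of_conjH1_eq` on `E[n]`) under the subgroup model (`modelIsoTorsion_conjAct`,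
`modelIsoTorsion_resTorsion`). [cite: SerreGaloisCohomology1997, I.§2.4 (Prop. 9 and Cor.) and I.§5.8]
[cite: GrossLMS1991, §5 (5.1)] -/
theorem exists_resTorsion_eq_of_conjAct_eq (ha₁ : W.a₁ = 0) (ha₂ : W.a₂ = 0)
    (ha₃ : W.a₃ = 0) (ha₄ : W.a₄ = 0) (h2 : Module.finrank ℚ K = 2) {ζ : K}
    (hζ : IsPrimitiveRoot ζ 3) {σ : K ≃ₐ[ℚ] K} (hσζ : σ ζ = ζ ^ 2)
    {s : galH1Torsion (W.baseChange K) n} (hs : conjAct W σ n s = s) :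
    ∃ η : galH1Torsion W n, resTorsion W K n η = s := by
  haveI : IsGalois ℚ K := by
    haveI : Algebra.IsQuadraticExtension ℚ K := ⟨h2⟩
    infer_instance
  haveI : Algebra.IsAlgebraic ℚ K := Algebra.IsAlgebraic.of_finite ℚ K
  have hσ1 : σ ≠ 1 := ne_one_of_apply_eq_sq₃ K hζ hσζ
  haveI hNn : (galRange (K := ℚ) K).Normal := normal_galRange K h2 hσ1
  have hN : IsOpen (galRange (K := ℚ) K : Set (Field.absoluteGaloisGroup ℚ)) := isOpen_galRange K
  have hc := xor_galRange K h2 hσ1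
  have hM := continuous_smul_geomTorsion W n
  obtain ⟨ζ', hζ'⟩ : ∃ ζ' : AlgebraicClosure ℚ, embIntoClosure (K := ℚ) K ζ = ζ' := ⟨_, rfl⟩
  have hζ'3 : ζ' ^ 3 = 1 := by rw [← hζ', ← map_pow, hζ.pow_eq_one, map_one]
  have hζ'1 : ζ' ≠ 1 :=
    (hζ' ▸ hζ.map_of_injective (embIntoClosure (K := ℚ) K).injective).ne_one (by norm_num)
  have hcζ : (show AlgebraicClosure ℚ ≃ₐ[ℚ] AlgebraicClosure ℚ from liftToAbsGal (K := ℚ) K σ) ζ' =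
      ζ' ^ 2 := by
    rw [← hζ']
    exact (liftToAbsGal_embIntoClosure (K := ℚ) K σ ζ).trans (by rw [hσζ, map_pow])
  obtain ⟨ψ, hψ1, hψ2, hψ3⟩ := exists_cm_addEquiv_torsion W n ha₁ ha₂ ha₃ ha₄ hζ'3 hζ'1
  have hψN : ∀ (g : galRange (K := ℚ) K) (m : geomTorsion W n), ψ (g • m) = g • ψ m :=
    fun g m ↦ hψ1 g.1 (by rw [← hζ']; exact smul_embIntoClosure_of_mem_galRange K g.2 ζ) m
  have hξ : conjH1 (galRange (K := ℚ) K) (geomTorsion W n) (liftToAbsGal (K := ℚ) K σ)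
      (modelIsoTorsion K W n s) = modelIsoTorsion K W n s := by
    rw [← modelIsoTorsion_conjAct K W n σ h2 hσ1, hs]
  obtain ⟨η, hη⟩ :=
    Literature.NumberTheory.EllipticCurves.exists_resSubgroupH1_eq_of_conjH1_eq hN hM hc ψ hψN
      (fun m ↦ hψ2 _ hcζ m) hψ3 hξ
  refine ⟨η, (modelIsoTorsion K W n).injective ?_⟩
  rw [modelIsoTorsion_resTorsion]
  exact hη

/-- **`res(H¹(ℚ, E[n])) = H¹(K, E_K[n])^{σ}`** (set form; `⊆` is the tree's `conjAct_resTorsion`).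
[cite: SerreGaloisCohomology1997, I.§2.4 (Prop. 9 and Cor.) and I.§5.8] [cite: GrossLMS1991, §5 (5.1)] -/
theorem range_resTorsion_eq (ha₁ : W.a₁ = 0) (ha₂ : W.a₂ = 0) (ha₃ : W.a₃ = 0) (ha₄ : W.a₄ = 0)
    (h2 : Module.finrank ℚ K = 2) {ζ : K} (hζ : IsPrimitiveRoot ζ 3) {σ : K ≃ₐ[ℚ] K}
    (hσζ : σ ζ = ζ ^ 2) :
    ((resTorsion W K n).range : Set (galH1Torsion (W.baseChange K) n)) =
      {s | conjAct W σ n s = s} := by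
  haveI : IsGalois ℚ K := by
    haveI : Algebra.IsQuadraticExtension ℚ K := ⟨h2⟩
    infer_instance
  ext s
  simp only [SetLike.mem_coe, AddMonoidHom.mem_range, Set.mem_setOf_eq]
  constructor
  · rintro ⟨η, rfl⟩
    exact conjAct_resTorsion K W n σ h2 (ne_one_of_apply_eq_sq₃ K hζ hσζ) η
  · exact fun hs ↦ exists_resTorsion_eq_of_conjAct_eq K W n ha₁ ha₂ ha₃ ha₄ h2 hζ hσζ hs

/-! ## The Selmer groups: `Sel_n(E/ℚ) ≅ Sel_n(E_K/K)^{σ}` -/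

/-- **`Sel_n(E/ℚ) = res⁻¹ Sel_n(E_K/K)`** in the cube-sum frame: `⊆` is the tree's
`resTorsion_mem_selmerGroup`; `⊇` is the exact local descent `JZero.mem_sha_iff_resBaseChange_mem_sha_rat`
through `Sel_n = (E[n] → E)_*⁻¹ Ш` (`selmerGroup_eq_comap_sha`, `torsionH1ToH1_resTorsion`).
[cite: DokchitserDokchitserAnnals2010, Lemma 4.14 (proof)]
[cite: SerreGaloisCohomology1997, I.§2.4 (Prop. 9 and Cor.) and I.§5.8] -/
theorem mem_selmerGroup_iff_resTorsion_mem (ha₁ : W.a₁ = 0) (ha₂ : W.a₂ = 0)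
    (ha₃ : W.a₃ = 0) (ha₄ : W.a₄ = 0) (h2 : Module.finrank ℚ K = 2) {ζ : K}
    (hζ : IsPrimitiveRoot ζ 3) (η : galH1Torsion W n) :
    η ∈ selmerGroup W n ↔ resTorsion W K n η ∈ selmerGroup (W.baseChange K) n := by
  rw [selmerGroup_eq_comap_sha, selmerGroup_eq_comap_sha, AddSubgroup.mem_comap,
    AddSubgroup.mem_comap, torsionH1ToH1_resTorsion]
  exact mem_sha_iff_resBaseChange_mem_sha_rat W ha₁ ha₂ ha₃ ha₄ K
    (sq_add_self_add_one_eq_zero K hζ) h2 _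

/-- **`Sel_n(E/ℚ)` is the preimage of `Sel_n(E_K/K)`** (subgroup form).
[cite: DokchitserDokchitserAnnals2010, Lemma 4.14 (proof)] -/
theorem selmerGroup_eq_comap_resTorsion (ha₁ : W.a₁ = 0) (ha₂ : W.a₂ = 0)
    (ha₃ : W.a₃ = 0) (ha₄ : W.a₄ = 0) (h2 : Module.finrank ℚ K = 2) {ζ : K}
    (hζ : IsPrimitiveRoot ζ 3) :
    selmerGroup W n = (selmerGroup (W.baseChange K) n).comap (resTorsion W K n) := by
  ext η
  rw [AddSubgroup.mem_comap]
  exact mem_selmerGroup_iff_resTorsion_mem K W n ha₁ ha₂ ha₃ ha₄ h2 hζ η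

/-- **`res : Sel_n(E/ℚ) ⥲ Sel_n(E_K/K)^{σ}` (finite level).** For `E : y² = x³ + B` over `ℚ`, `K`
quadratic with a primitive cube root of unity `ζ`, `σ ζ = ζ²`, and any `n : ℤ`: every `σ`-invariant
element of `Sel_n(E_K/K)` has EXACTLY ONE preimage under `res` in `H¹(ℚ, E[n])`, and it lies in
`Sel_n(E/ℚ)` (memo: «`Sel_{2^M}(X/K) = Sel_{2^M}(X/ℚ) ⊗ 𝒪/2^M`», `σ`-eigen form; Gross 1991 §5
(5.1)–(5.2) is the odd-`p` analogue `Sel(E/ℚ)_p ⥲ Sel(E/K)_p^{+}`). [cite: GrossLMS1991, §5 (5.1)]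
[cite: SerreGaloisCohomology1997, I.§2.4 (Prop. 9 and Cor.) and I.§5.8] -/
theorem existsUnique_resTorsion_eq_of_mem_selmerGroup (ha₁ : W.a₁ = 0) (ha₂ : W.a₂ = 0)
    (ha₃ : W.a₃ = 0) (ha₄ : W.a₄ = 0) (h2 : Module.finrank ℚ K = 2) {ζ : K}
    (hζ : IsPrimitiveRoot ζ 3) {σ : K ≃ₐ[ℚ] K} (hσζ : σ ζ = ζ ^ 2)
    {s : galH1Torsion (W.baseChange K) n} (hsel : s ∈ selmerGroup (W.baseChange K) n)
    (hs : conjAct W σ n s = s) :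
    ∃! η : galH1Torsion W n, η ∈ selmerGroup W n ∧ resTorsion W K n η = s := by
  obtain ⟨η, hη⟩ := exists_resTorsion_eq_of_conjAct_eq K W n ha₁ ha₂ ha₃ ha₄ h2 hζ hσζ hs
  refine ⟨η, ⟨(mem_selmerGroup_iff_resTorsion_mem K W n ha₁ ha₂ ha₃ ha₄ h2 hζ η).mpr
    (hη ▸ hsel), hη⟩, fun η' hη' ↦ ?_⟩
  exact resTorsion_injective K W n ha₁ ha₂ ha₃ ha₄ h2 hζ hσζ (hη'.2.trans hη.symm)

/-- **`res(Sel_n(E/ℚ)) = Sel_n(E_K/K) ∩ H¹(K, E_K[n])^{σ}`** (image form).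
[cite: GrossLMS1991, §5 (5.1)] [cite: SerreGaloisCohomology1997, I.§2.4 (Prop. 9 and Cor.) and I.§5.8] -/
theorem image_resTorsion_selmerGroup_eq (ha₁ : W.a₁ = 0) (ha₂ : W.a₂ = 0) (ha₃ : W.a₃ = 0)
    (ha₄ : W.a₄ = 0) (h2 : Module.finrank ℚ K = 2) {ζ : K} (hζ : IsPrimitiveRoot ζ 3)
    {σ : K ≃ₐ[ℚ] K} (hσζ : σ ζ = ζ ^ 2) :
    resTorsion W K n '' (selmerGroup W n : Set (galH1Torsion W n)) =
      {s | s ∈ selmerGroup (W.baseChange K) n ∧ conjAct W σ n s = s} := by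
  haveI : IsGalois ℚ K := by
    haveI : Algebra.IsQuadraticExtension ℚ K := ⟨h2⟩
    infer_instance
  ext s
  simp only [Set.mem_image, SetLike.mem_coe, Set.mem_setOf_eq]
  constructor
  · rintro ⟨η, hη, rfl⟩
    exact ⟨resTorsion_mem_selmerGroup W K n hη,
      conjAct_resTorsion K W n σ h2 (ne_one_of_apply_eq_sq₃ K hζ hσζ) η⟩
  · rintro ⟨hsel, hs⟩
    obtain ⟨η, ⟨hη, hres⟩, -⟩ := existsUnique_resTorsion_eq_of_mem_selmerGroup K W n
      ha₁ ha₂ ha₃ ha₄ h2 hζ hσζ hsel hs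
    exact ⟨η, hη, hres⟩

end JZero

end Literature.NumberTheory.EllipticCurves
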